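import Summits.Ventures.AbcShadow.SH27.NewformSide

/-!
# Venture AbcShadow — SH-27 NEWFORM SIDE: SOUNDNESS of the characteristic-17 realisation sieve (`orbitCheck_sound`)

HONEST FRAMING. Proof file of the work-bound cell `abc-shadow` (typer seat `abc-shadow-typ-4`, row SH-27); no claim on abc, on
any summit, or on IUT; no Diophantine statement; no modular-form computation is verified here (see `SH27/NewformSide.lean`
for what the checker is and `SH27/Che10Package.lean` for the named computed hypothesis `DataComplete`). PROVED: if
`orbitCheck o e fd R c = true` (kernel, `SH27/NewformData.lean`) then NO characteristic-17 realisation `(k, ι, θ, (ā_q))` of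
the orbit data `o` — `k` a field of characteristic 17, `ι² = −1`, `P(ι, θ) = 0`, `d_q ā_q = g_q(ι, θ)` — admits, for every
listed prime `q`, an integer `A` (in `R(q)` when supplied) with `p_{f(q)}(ā_q, ι^{e(q)}·q) = A` in `k`. Steps: `ι = ±4`
(`iota_cases`); `θ` is a root of one of the kernel-checked factors `m` of `P(±4, y) (mod 17)` (`prodCheck_sound`, `k` a
domain); in `𝔽₁₇[y]/(m)` realised inside `k` by `(a, b) ↦ a + bθ` (`toK`, multiplicative by `toK_mul` since `m(θ) = 0`) the
checker's `τ, d, L` ARE `ā_q, ι^{e}q, p_f(ā_q, ι^{e}q)` (`toK_evalQiR`, `toK_ptPair` with `SH27/PowerTrace.lean`); an `L` with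
nonzero `θ`-coordinate equal to an integer would put `θ ∈ 𝔽₁₇`, contradicting irreducibility of the quadratic `m`
(`factor_sound`); an `L ∈ 𝔽₁₇` equal to `A` forces `A ≡ L (mod 17)` (`ψ17_injective`). ADJACENT (generalized Fermat
`(2, 34, 5)`), NOT abc.
-/

namespace Summit.Ventures.AbcShadow
namespace SH27

/-! ## Soundness -/

section sound
variable {k : Type*} [Field k] [CharP k 17]

/-- `17` is prime (used as a local instance). [folklore] -/
theorem fact_prime_17 : Fact (Nat.Prime 17) := ⟨by norm_num⟩

/-- The embedding `𝔽₁₇ ↪ k`. [folklore] -/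
def ψ17 (k : Type*) [Field k] [CharP k 17] : ZMod 17 →+* k := ZMod.castHom (dvd_refl 17) k

/-- `ψ17` is injective. [folklore] -/
theorem ψ17_injective : Function.Injective (ψ17 k) := by
  haveI := fact_prime_17
  exact (ψ17 k).injective

/-- Interpretation of a pair: `(a, b) ↦ a + b·ȳ`. [folklore] -/
def toK (yb : k) (x : R17) : k := ψ17 k x.1 + ψ17 k x.2 * yb

/-- In characteristic 17, `ι² = −1` forces `ι = ±4`. [folklore] -/
theorem iota_cases (ι : k) (hι : ι ^ 2 = -1) : ι = ψ17 k 4 ∨ ι = ψ17 k 13 := by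
  have h17 : (17 : k) = 0 := by exact_mod_cast CharP.cast_eq_zero k 17
  have h4 : ψ17 k 4 = 4 := map_ofNat (ψ17 k) 4
  have h13 : ψ17 k 13 = 13 := map_ofNat (ψ17 k) 13
  have key : (ι - 4) * (ι - 13) = 0 := by linear_combination hι + (3 - ι) * h17
  rcases mul_eq_zero.mp key with h | h
  · left; rw [h4]; linear_combination h
  · right; rw [h13]; linear_combination h

/-- `toK` is additive. [folklore] -/
theorem toK_add (yb : k) (x y : R17) : toK yb (x + y) = toK yb x + toK yb y := by
  simp only [toK, Prod.fst_add, Prod.snd_add, map_add]; ring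

/-- `toK` and subtraction. [folklore] -/
theorem toK_sub (yb : k) (x y : R17) : toK yb (x - y) = toK yb x - toK yb y := by
  simp only [toK, Prod.fst_sub, Prod.snd_sub, map_sub]; ring

/-- `toK` and scalars. [folklore] -/
theorem toK_smul (yb : k) (c : ZMod 17) (x : R17) : toK yb (c • x) = ψ17 k c * toK yb x := by
  simp only [toK, Prod.smul_fst, Prod.smul_snd, smul_eq_mul, map_mul]; ring

/-- `toK` of a constant pair. [folklore] -/
theorem toK_const (yb : k) (c : ZMod 17) : toK yb ((c, 0) : R17) = ψ17 k c := by
  simp [toK]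

/-- `toK` is multiplicative for `mul17 n` when `ȳ² = n₁ȳ + n₀`. [folklore] -/
theorem toK_mul (yb : k) (n : ZMod 17 × ZMod 17) (hy : yb ^ 2 = ψ17 k n.2 * yb + ψ17 k n.1) (x y : R17) :
    toK yb (mul17 n x y) = toK yb x * toK yb y := by
  simp only [toK, mul17, map_add, map_mul]
  linear_combination (-(ψ17 k x.2 * ψ17 k y.2)) * hy

/-- `toK` of the pair evaluation of `g ∈ ℤ[i][y]` is the honest evaluation. [folklore] -/
theorem toK_evalQiR (yb : k) (n : ZMod 17 × ZMod 17) (hy : yb ^ 2 = ψ17 k n.2 * yb + ψ17 k n.1) (i0 : ℤ) (ybp : R17)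
    (hyb : toK yb ybp = yb) : ∀ g : QiPoly, toK yb (evalQiR n (i0 : ZMod 17) ybp g) = evalQi ((i0 : ℤ) : k) yb g
  | [] => by simp [evalQiR, evalQi, toK]
  | ab :: g => by
      rw [evalQiR, evalQi, toK_add, toK_mul yb n hy, hyb, toK_evalQiR yb n hy i0 ybp hyb g]
      congr 1
      simp only [toK, map_add, map_mul, map_intCast, map_zero, zero_mul, add_zero]

/-- `toK` of `ptPair` is the power trace, for `f ∈ {1, 2, 4}`. [folklore] -/
theorem toK_ptPair (yb : k) (n : ZMod 17 × ZMod 17) (hy : yb ^ 2 = ψ17 k n.2 * yb + ψ17 k n.1) (f : ℕ)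
    (hf : f = 1 ∨ f = 2 ∨ f = 4) (τ : R17) (d : ZMod 17) :
    toK yb (ptPair n f τ d) = powerTrace (toK yb τ) (ψ17 k d) f := by
  rcases hf with rfl | rfl | rfl
  · simp [ptPair, powerTrace]
  · rw [ptPair, powerTrace_two, toK_sub, toK_mul yb n hy, toK_const, map_mul, map_ofNat]
    ring
  · rw [ptPair, powerTrace_four, toK_add, toK_sub, toK_smul, toK_mul yb n hy, toK_mul yb n hy, toK_const, map_mul,
      map_mul, map_mul, map_ofNat, map_ofNat]
    ring

/-- From `factorOK f` and `f(ȳ) = 0`: the relation `ȳ² = n₁ȳ + n₀` of `relOf f`, `toK (ybarOf f) = ȳ`, and — for a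
quadratic `f` — `ȳ ∉ 𝔽₁₇`. [folklore] -/
theorem factor_sound {f : Fac} (hm : factorOK f = true) {yb : k} (hroot : evalZ yb f.toList = 0) :
    yb ^ 2 = ψ17 k (relOf f).2 * yb + ψ17 k (relOf f).1 ∧ toK yb (ybarOf f) = yb ∧
      (f.quad = true → ∀ r : ZMod 17, yb ≠ ψ17 k r) := by
  obtain ⟨qd, m0, m1⟩ := f
  cases qd
  · -- linear factor `y + m₀`
    have h1 : yb = -((m0 : ℤ) : k) := by
      simp only [Fac.toList, if_false, evalZ_cons, evalZ_nil, Int.cast_one, Bool.false_eq_true] at hroot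
      linear_combination hroot
    refine ⟨?_, ?_, fun h => by cases h⟩
    · simp only [relOf, if_false, Bool.false_eq_true, map_neg, map_intCast, map_zero, add_zero]; rw [h1]; ring
    · simp only [ybarOf, toK, if_false, Bool.false_eq_true, map_neg, map_intCast, map_zero, zero_mul, add_zero, h1]
  · -- quadratic factor `y² + m₁y + m₀`
    have h2 : yb ^ 2 + ((m1 : ℤ) : k) * yb + ((m0 : ℤ) : k) = 0 := by
      simp only [Fac.toList, if_true, evalZ_cons, evalZ_nil, Int.cast_one] at hroot
      linear_combination hroot
    refine ⟨?_, ?_, fun _ r hr => ?_⟩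
    · simp only [relOf, if_true, map_neg, map_intCast]; linear_combination h2
    · simp [ybarOf, toK]
    · simp only [factorOK, if_true, decide_eq_true_eq] at hm
      apply hm r
      apply ψ17_injective (k := k)
      simp only [map_add, map_mul, map_intCast, map_zero]
      rw [← hr]; linear_combination h2

/-- The entry found by `killAt` belongs to the orbit and is at `q`. [folklore] -/
theorem find_entry {o : Orbit27} {q : ℕ} {en : Entry27} (h : o.entries.find? (fun en => en.q == q) = some en) :
    en ∈ o.entries ∧ en.q = q := by
  refine ⟨List.mem_of_find?_eq_some h, ?_⟩
  have := List.find?_some h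
  simpa using this

/-- `inv17` returns an inverse mod 17. [folklore] -/
theorem inv17_sound {d : ℤ} {x : ZMod 17} (h : inv17 d = some x) : (d : ZMod 17) * x = 1 := by
  simp only [inv17, Option.map_eq_some_iff] at h
  obtain ⟨n, hn, rfl⟩ := h
  have := List.find?_some hn
  simpa using this

/-- **Soundness of the kill test.** If `killAt … i₀ f q` passes, `f` is a good factor with root `ȳ`, `ι = i₀`, the entries
hold for `(ā_q)`, and `p_{f(q)}(ā_q, ι^{e(q)} q) = A` for an integer `A` (in `R(q)` when supplied), contradiction. [folklore] -/
theorem killAt_sound {o : Orbit27} {e fd : ℕ → ℕ} {R : ℕ → Option (List ℤ)} {i0 : ℤ} {f : Fac} {q : ℕ}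
    (hk : killAt o e fd R i0 f q = true) (hm : factorOK f = true) {ι yb : k} (hι : ι = ((i0 : ℤ) : k))
    (hroot : evalZ yb f.toList = 0) (a : ℕ → k) (ha : ∀ en ∈ o.entries, (en.d : k) * a en.q = evalQi ι yb en.g)
    {A : ℤ} (hAR : ∀ l, R q = some l → A ∈ l) (hid : powerTrace (a q) (ι ^ e q * q) (fd q) = (A : k)) : False := by
  haveI := fact_prime_17
  obtain ⟨hy, hyb, hirr⟩ := factor_sound hm hroot
  unfold killAt at hk
  split at hk
  · simp at hk
  · rename_i en hen
    obtain ⟨hen_mem, hen_q⟩ := find_entry hen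
    split at hk
    · simp at hk
    · rename_i dinv hdinv
      have hdd := inv17_sound hdinv
      simp only [Bool.and_eq_true, Bool.or_eq_true, beq_iff_eq, decide_eq_true_eq] at hk
      obtain ⟨hf, hk⟩ := hk
      set n := relOf f with hn
      set τ : R17 := dinv • evalQiR n (i0 : ZMod 17) (ybarOf f) en.g with hτ
      set dd : ZMod 17 := (i0 : ZMod 17) ^ e q * (q : ZMod 17) with hdd'
      set L := ptPair n (fd q) τ dd with hLdef
      have hunit : ψ17 k dinv * (en.d : k) = 1 := by
        rw [← map_intCast (ψ17 k) en.d, ← map_mul, mul_comm, hdd, map_one]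
      have hτK : toK yb τ = a q := by
        have h1 : toK yb τ = ψ17 k dinv * evalQi ι yb en.g := by
          rw [hτ, toK_smul, toK_evalQiR yb n hy i0 (ybarOf f) hyb, ← hι]
        rw [h1, ← ha en hen_mem, hen_q, ← mul_assoc, hunit, one_mul]
      have hddK : ψ17 k dd = ι ^ e q * q := by
        rw [hdd', map_mul, map_pow, map_intCast, map_natCast, hι]
      have hL : toK yb L = (A : k) := by
        rw [hLdef, toK_ptPair yb n hy (fd q) (by omega) τ dd, hτK, hddK, hid]
      have hψA : (A : k) = ψ17 k (A : ZMod 17) := (map_intCast _ _).symm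
      rcases hk with ⟨hquad, hL2⟩ | ⟨hL2, hR⟩
      · -- `L ∉ 𝔽₁₇` would put `ȳ` in `𝔽₁₇`
        have h1 : ψ17 k L.1 + ψ17 k L.2 * yb = ψ17 k (A : ZMod 17) := by rw [← hψA, ← hL]; rfl
        have h2 : ψ17 k L.2 ≠ 0 := fun h0 => hL2 (ψ17_injective (by rw [h0, map_zero]))
        have h3 : yb = (ψ17 k (A : ZMod 17) - ψ17 k L.1) * (ψ17 k L.2)⁻¹ := by
          field_simp
          linear_combination h1
        refine hirr hquad (((A : ZMod 17) - L.1) * L.2⁻¹) ?_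
        rw [map_mul, map_sub, map_inv₀]
        exact h3
      · -- `L ∈ 𝔽₁₇` but not congruent to any realised trace
        unfold notRealised at hR
        split at hR
        · simp at hR
        · rename_i l hl
          have hA := List.all_eq_true.mp hR A (hAR l hl)
          simp only [decide_eq_true_eq] at hA
          apply hA
          apply ψ17_injective (k := k)
          have h1 : toK yb L = ψ17 k L.1 := by rw [toK, hL2, map_zero, zero_mul, add_zero]
          rw [← hψA, ← hL, h1]

/-- **Soundness of a branch.** [folklore] -/
theorem branchCheck_sound {o : Orbit27} {e fd : ℕ → ℕ} {R : ℕ → Option (List ℤ)} {primes : List ℕ} {i0 : ℤ}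
    {facs : List Fac} (hb : branchCheck o e fd R primes i0 facs = true) {ι θ : k} (hι : ι = ((i0 : ℤ) : k))
    (hP : evalQi ι θ o.P = 0) (a : ℕ → k) (ha : ∀ en ∈ o.entries, (en.d : k) * a en.q = evalQi ι θ en.g)
    (hid : ∀ q ∈ primes, ∃ A : ℤ, (∀ l, R q = some l → A ∈ l) ∧ powerTrace (a q) (ι ^ e q * q) (fd q) = (A : k)) :
    False := by
  simp only [branchCheck, Bool.and_eq_true, List.all_eq_true, List.any_eq_true] at hb
  obtain ⟨hprod, hfacs⟩ := hb
  have hPz : evalZ θ (specQi i0 o.P) = 0 := by rw [← evalQi_intCast, ← hι]; exact hP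
  rw [prodCheck_sound θ hprod, List.prod_eq_zero_iff, List.mem_map] at hPz
  obtain ⟨m, hm_mem, hroot⟩ := hPz
  obtain ⟨f, hf_mem, rfl⟩ := List.mem_map.mp hm_mem
  obtain ⟨hmOK, q, hq, hkill⟩ := hfacs f hf_mem
  obtain ⟨A, hAR, hidq⟩ := hid q hq
  exact killAt_sound hkill hmOK hι hroot a ha hAR hidq

/-- **SOUNDNESS OF THE ORBIT CHECK.** If `orbitCheck o e fd R c` passes then there is NO characteristic-17 realisation
`(k, ι, θ, ā)` of the orbit data `o` (`ι² = −1`, `P(ι, θ) = 0`, `d_q ā_q = g_q(ι, θ)`) for which every listed prime `q` admits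
an integer `A` (in `R(q)` when supplied) with `p_{f(q)}(ā_q, ι^{e(q)} q) = A` in `k`. [folklore] -/
theorem orbitCheck_sound {o : Orbit27} {e fd : ℕ → ℕ} {R : ℕ → Option (List ℤ)} {c : Cert27}
    (hc : orbitCheck o e fd R c = true) {ι θ : k} (hι : ι ^ 2 = -1) (hP : evalQi ι θ o.P = 0) (a : ℕ → k)
    (ha : ∀ en ∈ o.entries, (en.d : k) * a en.q = evalQi ι θ en.g)
    (hid : ∀ q ∈ c.primes, ∃ A : ℤ, (∀ l, R q = some l → A ∈ l) ∧ powerTrace (a q) (ι ^ e q * q) (fd q) = (A : k)) :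
    False := by
  simp only [orbitCheck, Bool.and_eq_true] at hc
  rcases iota_cases ι hι with h | h
  · exact branchCheck_sound hc.1 (by rw [h, map_ofNat]; norm_num) hP a ha hid
  · exact branchCheck_sound hc.2 (by rw [h, map_ofNat]; norm_num) hP a ha hid

end sound

end SH27
end Summit.Ventures.AbcShadow
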